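import Literature.Topology.FourManifolds.FishtailZoneNorth
import HarnessLib

/-!
# Conversions of the fishtail tube coordinates to exponential coordinates of the mapping torus

Infrastructure for the explicit fishtail neighbourhood (R. Gompf, *More Cappell–Shaneson spheres
are standard*, Algebr. Geom. Topol. 10 (2010), proof of Thm 2.1 and Lemma 2.2; the named fact
`Literature.Topology.FourManifolds.gompf2010_framedTwist`). The pieces of the tube about Gompf's
disc are written in three coordinate systems: physical `(n, y, ℓ, t)` (box, corner, leg, path,
vertical segment), the cap chart `(P = d - d₀, y, ℓ)` (collar annulus, `FishtailTubeA*.lean`),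
and the cap chart with base `(d, a, b)` (`FishtailZoneNorth.lean`, converted there). This file
converts the first two to the exponential coordinates `((n - ℓ, y, ℓ), s)` of `mtCoord`
(`MTorusCoordinates.lean`) and records that the conversions are injective local diffeomorphisms:

* `Literature.Topology.FourManifolds.physAssemble (n, y, ℓ, t) = ((n - ℓ, y, ℓ), t)` — a
  diffeomorphism `ℝ⁴ ≅ 𝔼³ × ℝ`;
* `Literature.Topology.FourManifolds.aConv ε n_j (P, y, ℓ) = ((n - ℓ, y, ℓ), s)`,
  `(n, s) = (capN ε (d₀ + P), capS (d₀ + P))` — injective (`aConv_inj`) and a local diffeomorphism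
  where `d₀ + P` is in the slit plane (`isLocalDiffeomorphAt_aConv`).

Everything is proved; no named facts.

## References

* R. E. Gompf, *More Cappell–Shaneson spheres are standard*, Algebr. Geom. Topol. 10 (2010)
  1665–1681, proof of Thm 2.1 and Lemma 2.2. [GompfAGT2010]
-/

noncomputable section

open scoped Real ContDiff Topology Manifold
open Set Function Filter Complex

namespace Literature.Topology.FourManifolds

local notation "𝔼" n => EuclideanSpace ℝ (Fin n)

/-! ### Physical coordinates -/

section Phys

/-- **Physical to exponential coordinates**: `(n, y, ℓ, t) ↦ ((n - ℓ, y, ℓ), t)`, a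
diffeomorphism. [folklore] -/
def physAssemble : (ℝ × ℝ × ℝ × ℝ) ≃ₘ⟮𝓘(ℝ, ℝ × ℝ × ℝ × ℝ), 𝓘(ℝ, (𝔼 3) × ℝ)⟯ ((𝔼 3) × ℝ) where
  toFun q := (WithLp.toLp 2 ![q.1 - q.2.2.1, q.2.1, q.2.2.1], q.2.2.2)
  invFun r := (r.1 0 + r.1 2, r.1 1, r.1 2, r.2)
  left_inv q := by
    obtain ⟨n, y, ℓ, t⟩ := q
    simp
  right_inv r := by
    obtain ⟨v, t⟩ := r
    refine Prod.ext ?_ rfl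
    ext j
    fin_cases j <;> simp
  contMDiff_toFun := by
    refine contMDiff_iff_contDiff.2 ?_
    have h1 : ContDiff ℝ ∞ fun q : ℝ × ℝ × ℝ × ℝ ↦ q.1 := contDiff_fst
    have h2 : ContDiff ℝ ∞ fun q : ℝ × ℝ × ℝ × ℝ ↦ q.2.1 := contDiff_fst.comp contDiff_snd
    have h3 : ContDiff ℝ ∞ fun q : ℝ × ℝ × ℝ × ℝ ↦ q.2.2.1 := contDiff_fst.comp (contDiff_snd.comp contDiff_snd)
    have h4 : ContDiff ℝ ∞ fun q : ℝ × ℝ × ℝ × ℝ ↦ q.2.2.2 := contDiff_snd.comp (contDiff_snd.comp contDiff_snd)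
    refine ContDiff.prodMk ?_ h4
    rw [contDiff_piLp]
    intro j
    fin_cases j
    · exact h1.sub h3
    · exact h2
    · exact h3
  contMDiff_invFun := by
    refine contMDiff_iff_contDiff.2 ?_
    have hc : ∀ j : Fin 3, ContDiff ℝ ∞ fun r : (𝔼 3) × ℝ ↦ r.1 j := fun j ↦
      (contDiff_piLp_apply (p := 2) (i := j)).comp contDiff_fst
    exact ((hc 0).add (hc 2)).prodMk ((hc 1).prodMk ((hc 2).prodMk contDiff_snd))

/-- The value of `physAssemble`. [folklore] -/
@[simp] theorem physAssemble_apply (q : ℝ × ℝ × ℝ × ℝ) :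
    physAssemble q = (WithLp.toLp 2 ![q.1 - q.2.2.1, q.2.1, q.2.2.1], q.2.2.2) := rfl

/-- `expT` of the exponential coordinates is the torus point `(e^{i(n-ℓ)}, e^{iy}, e^{iℓ})`. [folklore] -/
theorem expT_physAssemble (q : ℝ × ℝ × ℝ × ℝ) :
    expT (physAssemble q).1 = (Circle.exp (q.1 - q.2.2.1), Circle.exp q.2.1, Circle.exp q.2.2.1) := by
  simp [expT]

end Phys

/-! ### The cap chart offset coordinates -/

section AConv

variable (ε nj : ℝ)

/-- **Cap-chart offset to exponential coordinates**: `(P, y, ℓ) ↦ ((n - ℓ, y, ℓ), s)` with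
`(n, s) = (capN ε (d₀ + P), capS (d₀ + P))`. [folklore] -/
def aConv (q : ℂ × ℝ × ℝ) : (𝔼 3) × ℝ :=
  (WithLp.toLp 2 ![capN ε (capD0 ε nj + q.1) - q.2.2, q.2.1, q.2.2], capS (capD0 ε nj + q.1))

variable {ε nj}

/-- The conversion factors: `aConv = northAssemble ∘ (capChart (d₀ + P), (y, ℓ))`. [folklore] -/
theorem aConv_eq (q : ℂ × ℝ × ℝ) :
    aConv ε nj q = northAssemble ((capN ε (capD0 ε nj + q.1), capS (capD0 ε nj + q.1)), q.2) := rfl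

/-- **The conversion is injective** (the cap chart has the global left inverse `capPt`). [folklore] -/
theorem aConv_inj (hε : 0 < ε) {q q' : ℂ × ℝ × ℝ} (h : aConv ε nj q = aConv ε nj q') : q = q' := by
  have h0 := congrArg (fun r : (𝔼 3) × ℝ ↦ r.1 0) h
  have h1 := congrArg (fun r : (𝔼 3) × ℝ ↦ r.1 1) h
  have h2 := congrArg (fun r : (𝔼 3) × ℝ ↦ r.1 2) h
  have hs := congrArg Prod.snd h
  simp only [aConv, PiLp.toLp_apply, Matrix.cons_val_zero, Matrix.cons_val_one, Matrix.cons_val] at h0 h1 h2 hs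
  have hN : capN ε (capD0 ε nj + q.1) = capN ε (capD0 ε nj + q'.1) := by linarith
  have hd : capD0 ε nj + q.1 = capD0 ε nj + q'.1 := by
    rw [← capPt_capN_capS hε (capD0 ε nj + q.1), ← capPt_capN_capS hε (capD0 ε nj + q'.1), hN, hs]
  exact Prod.ext (add_left_cancel hd) (Prod.ext h1 h2)

/-- **The conversion is a local diffeomorphism** where `d₀ + P` is in the slit plane. [folklore] -/
theorem isLocalDiffeomorphAt_aConv (hε : 0 < ε) {q : ℂ × ℝ × ℝ} (hd : capD0 ε nj + q.1 ∈ slitPlane) :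
    IsLocalDiffeomorphAt 𝓘(ℝ, ℂ × ℝ × ℝ) 𝓘(ℝ, (𝔼 3) × ℝ) ∞ (aConv ε nj) q := by
  -- translate, cap chart times identity, assemble
  have h0 : IsLocalDiffeomorphAt 𝓘(ℝ, ℂ × ℝ × ℝ) 𝓘(ℝ, ℂ × ℝ × ℝ) ∞ (fun q : ℂ × ℝ × ℝ ↦ (capD0 ε nj + q.1, q.2)) q := by
    let T : (ℂ × ℝ × ℝ) ≃ₘ⟮𝓘(ℝ, ℂ × ℝ × ℝ), 𝓘(ℝ, ℂ × ℝ × ℝ)⟯ (ℂ × ℝ × ℝ) :=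
      { toFun := fun q ↦ (capD0 ε nj + q.1, q.2)
        invFun := fun q ↦ (q.1 - capD0 ε nj, q.2)
        left_inv := fun q ↦ by simp
        right_inv := fun q ↦ by simp
        contMDiff_toFun := contMDiff_iff_contDiff.2 ((contDiff_const.add contDiff_fst).prodMk contDiff_snd)
        contMDiff_invFun := contMDiff_iff_contDiff.2 ((contDiff_fst.sub contDiff_const).prodMk contDiff_snd) }
    exact T.isLocalDiffeomorph q
  have h1 : IsLocalDiffeomorphAt 𝓘(ℝ, ℂ × ℝ × ℝ) 𝓘(ℝ, (ℝ × ℝ) × (ℝ × ℝ)) ∞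
      (fun q : ℂ × ℝ × ℝ ↦ ((capN ε q.1, capS q.1), q.2)) (capD0 ε nj + q.1, q.2) := by
    have h := IsLocalDiffeomorphAt.prodMap' (isLocalDiffeomorphAt_capChart hε hd)
      ((Diffeomorph.refl 𝓘(ℝ, ℝ × ℝ) (ℝ × ℝ) ∞).isLocalDiffeomorph q.2)
    rw [← modelWithCornersSelf_prod, ← modelWithCornersSelf_prod, chartedSpaceSelf_prod,
      chartedSpaceSelf_prod] at h
    exact h
  have h2 := northAssemble.isLocalDiffeomorph ((capN ε (capD0 ε nj + q.1), capS (capD0 ε nj + q.1)), q.2)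
  have h := (h0.comp (K := 𝓘(ℝ, (ℝ × ℝ) × (ℝ × ℝ))) (P := (ℝ × ℝ) × (ℝ × ℝ)) h1).comp
    (K := 𝓘(ℝ, (𝔼 3) × ℝ)) (P := (𝔼 3) × ℝ) h2
  exact isLocalDiffeomorphAt_congr_nhds' h (Eventually.of_forall fun q' ↦ rfl)

/-- Smoothness of the conversion where `d₀ + P` is in the slit plane. [folklore] -/
theorem contDiffAt_aConv {q : ℂ × ℝ × ℝ} (hd : capD0 ε nj + q.1 ∈ slitPlane) : ContDiffAt ℝ ∞ (aConv ε nj) q := by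
  have h0 : capD0 ε nj + q.1 ≠ 0 := slitPlane_ne_zero hd
  have htr : ContDiff ℝ ∞ fun q : ℂ × ℝ × ℝ ↦ capD0 ε nj + q.1 := contDiff_const.add contDiff_fst
  have hN : ContDiffAt ℝ ∞ (fun q : ℂ × ℝ × ℝ ↦ capN ε (capD0 ε nj + q.1)) q :=
    ContDiffAt.comp (g := capN ε) (f := fun q : ℂ × ℝ × ℝ ↦ capD0 ε nj + q.1) q (contDiffAt_capN ε h0) htr.contDiffAt
  have hS : ContDiffAt ℝ ∞ (fun q : ℂ × ℝ × ℝ ↦ capS (capD0 ε nj + q.1)) q :=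
    ContDiffAt.comp (g := capS) (f := fun q : ℂ × ℝ × ℝ ↦ capD0 ε nj + q.1) q (contDiffAt_capS hd) htr.contDiffAt
  unfold aConv
  refine ContDiffAt.prodMk ?_ hS
  rw [contDiffAt_piLp]
  intro j
  fin_cases j
  · exact hN.sub (contDiff_snd.comp contDiff_snd).contDiffAt
  · exact (contDiff_fst.comp contDiff_snd).contDiffAt
  · exact (contDiff_snd.comp contDiff_snd).contDiffAt

/-- `expT` of the converted coordinates is the torus point `(e^{i(n-ℓ)}, e^{iy}, e^{iℓ})`,
`n = capN ε (d₀ + P)`. [folklore] -/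
theorem expT_aConv (q : ℂ × ℝ × ℝ) :
    expT (aConv ε nj q).1 =
      (Circle.exp (capN ε (capD0 ε nj + q.1) - q.2.2), Circle.exp q.2.1, Circle.exp q.2.2) := by
  simp [aConv, expT]

end AConv

end Literature.Topology.FourManifolds
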